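import Summits.HodgeConjecture.HodgeConjecture.Theorems.Ring2WeilCoverageRamifiedTypes
import Summits.HodgeConjecture.HodgeConjecture.Theorems.Ring2WeilCoverageRamifiedPrimePowers
import Summits.HodgeConjecture.HodgeConjecture.Theorems.Ring2WeilCoverageRamifiedPrimePowerFive
import Summits.HodgeConjecture.HodgeConjecture.Theorems.Ring2WeilCoverageCyclotomicSignaturesG12D
import Summits.HodgeConjecture.HodgeConjecture.Theorems.Ring2WeilCoverageCyclotomicUnconditionalSqrtFive
import HarnessLib

/-!
# Weil-type family coverage — THE SECOND RAMIFIED TYPE AT LEVELS `35` AND `45`: every `K`-balanced CM type of `ℚ(ζ₃₅)`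
# (`K = ℚ(√−7), ℚ(√−35)`) resp. `ℚ(ζ₄₅)` (`K = ℚ(√−3), ℚ(√−15)`) also carries a polarisation of type `𝔮₅` (`𝔮₅⁴ = (5)`,
# `N(𝔬𝔣₀) = 5⁶`, degree `125`, elementary divisors `(1⁹, 5, 5, 5)`) — whose polarised CM points lie on the NON-SPLIT components
# `T = {5, 7}` resp. `T = {3, 5}` of the twelve-dimensional Weil loci (S-pencil)

research route conditional on HC_CM; not a corollary; Q11.4-sentence-2 already refuted in dim ≥ 3.

Ring 2, WEIL-TYPE FAMILY-COVERAGE CENSUS (`HOME/WEIL-FAMILY-COVERAGE.md` `## b01`, blocks b01.27 (Fermat twelvefolds at 35), b01.38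
(the four NO rows at 35/45), this gen's parts 48b/48d/51 (THEOREM L (ii) at 35/45; `(1 − η)⁴𝓞 = 5𝓞`; the first ramified types
`𝔮₇` / `𝔮₃`, split components); owner ring2-b01), part 52b of the `Ring2WeilCoverage*` series.  At `35` and `45` the prime of
`ℚ(ζ_M)⁺` over `5` is inert in `ℚ(ζ_M)` (`5` has order `6` mod `7`, resp. mod `9`), so it flips the principal verdict as well:

* level `35`, `π = ζ³¹(1 − ζ⁷)(1 − ζ)` (`ζ⁷` a primitive 5th root: `(π) = 𝔭₅`, `(π)⁴ = (5)`): `twistSet_thirtyFiveB`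
  (`X_π = {2, 4, 6, 9, 11, 13, 16, 18, 23, 27, 32, 34}`, `|A_π|/2 = 7`), `map_type_pow_thirtyFiveB` (`(𝔬𝔣₀)⁴ = (5)`),
  **`exists_type_thirtyFiveB_sqrt_neg_seven/_thirtyFive`** (+ `exists_ramifiedType_…`);
* level `45`, `π = ζ⁴⁰(1 − ζ⁹)(1 − ζ)` (`ζ⁹` a primitive 5th root: `(π) = 𝔭₅`, `(π)⁴ = (5)`): `twistSet_fortyFiveB`
  (`X_π = {2, 8, 11, 14, 16, 19, 22, 28, 32, 38, 41, 44}`, `|A_π|/2 = 7`), `map_type_pow_fortyFiveB` (`(𝔬𝔣₀)⁴ = (5)`),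
  **`exists_type_fortyFiveB_sqrt_neg_three/_fifteen`** (+ `exists_ramifiedType_…`).

COMPONENTS (S-pencil, exact; `a = (−1)ⁿ det(δ·Tr_{L/K}(ζ′ζ^{j−k}))`, [vG94 5.2]): on the `K`-balanced tori the principal `ξ` gives
`a = −1` (the NO rows), part 51's types give `a = 49` resp. `9` (`≡ 1`, SPLIT), and THESE degree-`125` types give `a = 125 ≡ 5` with
`T(a) = {5, 7}` at `35` (both `K`) and `T(a) = {3, 5}` at `45` (both `K`): **`ℤ[ζ₃₅]`- and `ℤ[ζ₄₅]`-CM points of Weil type on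
NON-split components** (for `ℚ(√−7)`: `5` is inert, `(125, −7)₅ = −1`; for `ℚ(√−3)`: `5` inert; for `ℚ(√−35)`, `ℚ(√−15)`: both
primes of `T` ramified).

HONEST FRAMING: torus-level statements about Shimura's divisors `X_ζ′` of type `(K; Φ; 𝔣₀)` on the principal CM torus
`ℂ^Φ/Φ(ℤ[ζ_M])` [Sh98 §14.3 Prop. 4–5] and elementary ideal arithmetic in `ℤ[ζ_M]`; all residue sets are displayed and checked
by `decide`; the COMPONENT statements (hermitian discriminant classes `a`, sets `T(a)`) are S-pencil — exact determinants of the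
`K`-hermitian Gram matrices `Tr_{L/K}(πξ ζ^{j−k})` computed outside the kernel (`work/py/component.py`, mirror
`pub-hodge-ring2-b01/g61/py/`) — and are quoted in the docstrings only; nothing here is a statement about Hodge classes, `W_K`,
general members or HC; `HC_CM` is used nowhere.  No `def`, no named fact, no `sorry`.

References: [cite: Shimura1998, §14.3 Prop. 4–5, pp. 103–104]; [cite: Washington1997, §8.1, Lemma 1.4, Prop. 2.8];
[cite: vanGeemen1994HodgeAV, Lemma 5.2, Thm. 5.10] (discriminant class of a Weil-type polarisation); census b01.17 / b01.38 (seat-derived).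
-/

noncomputable section

open Polynomial NumberField Complex Finset
open scoped Real nonZeroDivisors

namespace Summit.HodgeConjecture.Ring2WeilCoverage.RamifiedTypesLevels35and45PrimeFive

open Literature.AlgebraicGeometry.Motives (CMType)
open Literature.AlgebraicGeometry.HodgeTheory (IsCMTypeSet)
open Literature.AlgebraicGeometry.ComplexMultiplication.CyclotomicCMType (isCMTypeSet_residueFilter)
open Literature.NumberTheory.ComplexMultiplication
open Summit.HodgeConjecture.Ring2WeilCoverage.RamifiedTypes
open Summit.HodgeConjecture.Ring2WeilCoverage.RamifiedPrimePowers
open Summit.HodgeConjecture.Ring2WeilCoverage.CyclotomicUnitProducts (isUnit_one_sub_toInteger_pow)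
open Summit.HodgeConjecture.Ring2WeilCoverage.CMTypeSetPairCount (card_inter_add_card_inter_eq)
open Summit.HodgeConjecture.Ring2WeilCoverage.CMTypeSetOddPositions (two_mul_card_eq_card_units)
open Summit.HodgeConjecture.Ring2WeilCoverage.RamifiedPrimePowerFive (span_one_sub_pow_eq_five)
open Summit.HodgeConjecture.Ring2WeilCoverage.CyclotomicSignaturesG12D (exists_units_sign_eq_thirtyFive exists_units_sign_eq_fortyFive)
open Summit.HodgeConjecture.Ring2WeilCoverage.CyclotomicUnconditionalSqrtFive (norm_realUnits_pos_thirtyFive norm_realUnits_pos_fortyFive)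

variable {K : Type} [Field K] [NumberField K] {ζ : K}

/-- `𝐞(t) = exp(2πi t/n) ∈ ℂ` (`ZMod.toCircle`). -/
local notation3 (prettyPrint := false) "𝐞 " t:max => ((ZMod.toCircle t : Circle) : ℂ)

section Level35

/-- the residue set `S_Φ` read at level `35`. -/
local notation3 (prettyPrint := false) "SΦ[" Φ "," z "]" =>
  (Finset.univ.filter fun t : ZMod 35 => ∃ σ ∈ (Φ : CMType K).1, σ (z : K) = 𝐞 t)

/-- part 48's twisted sign set `X_π` at level `35` (`n := 35`). -/
local notation3 (prettyPrint := false) "Xtw35 " x:max =>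
  (Finset.univ.filter fun t : ZMod 35 => t.val.Coprime 35 ∧
    ¬ ((35 < (x : ℕ × ℕ × ℕ).1 * ZMod.val t % (2 * 35) ↔ 35 < (x : ℕ × ℕ × ℕ).2.1 * ZMod.val t % (2 * 35)) ↔
      Even (Finset.card (Finset.filter (fun s : ZMod 35 => s.val.Coprime 35 ∧ s.val < t.val) Finset.univ))))

/-- the census's `N_odd` at level `35` (part 5). -/
local notation3 (prettyPrint := false) "Nodd35" =>
  (Finset.univ.filter fun t : ZMod 35 => t.val.Coprime 35 ∧
    Even (Finset.card (Finset.filter (fun s : ZMod 35 => s.val.Coprime 35 ∧ s.val < t.val) Finset.univ)))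

/-! #### Level `35`, the type `𝔣₀` with `𝔬𝔣₀ = (π)`, `π = ζ^31(1 − ζ^7)(1 − ζ^1)` (`ζ^7` a primitive `5`-th root of unity: `(π) = (1 − ζ^7)`, `(π)^4 = (5)`) -/

/-- the semi-admissibility of `x = (7, 1, 31)` at level `35` (`35 ∤ 7, 1`; `2·31 + 7 + 1 ≡ 0 (mod 70)`). [folklore] -/
theorem adm_thirtyFiveB : ¬ 35 ∣ ((7, 1, 31) : ℕ × ℕ × ℕ).1 ∧ ¬ 35 ∣ ((7, 1, 31) : ℕ × ℕ × ℕ).2.1 ∧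
    (2 * ((7, 1, 31) : ℕ × ℕ × ℕ).2.2 + ((7, 1, 31) : ℕ × ℕ × ℕ).1 + ((7, 1, 31) : ℕ × ℕ × ℕ).2.1) % (2 * 35) = 0 := by
  decide

/-- **The twisted sign set at level `35` for `π = ζ^31(1 − ζ^7)(1 − ζ^1)`: `X_π = N_odd ∆ A_π = [2, 4, 6, 9, 11, 13, 16, 18, 23, 27, 32, 34]`** (`A_π = [1, 2, 3, 4, 11, 12, 13, 22, 23, 24, 31, 32, 33, 34]`, `|A_π|/2 = 7`;
`decide`).
research route conditional on HC_CM; not a corollary; Q11.4-sentence-2 already refuted in dim ≥ 3. [folklore] -/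
theorem twistSet_thirtyFiveB : Xtw35 ((7, 1, 31) : ℕ × ℕ × ℕ) = ({2, 4, 6, 9, 11, 13, 16, 18, 23, 27, 32, 34} : Finset (ZMod 35)) := by
  decide

/-- **A type `𝔣₀ ⊆ 𝓞 K⁺` with `𝔬𝔣₀ = (π)`, `π = ζ^31(1 − ζ^7)(1 − ζ^1)`, EXISTS** (part 48 `exists_ideal_map_eq_span_gen`).
research route conditional on HC_CM; not a corollary; Q11.4-sentence-2 already refuted in dim ≥ 3. [cite: Shimura1998, §14.3, p. 103] -/
theorem exists_type_ideal_thirtyFiveB [IsCMField K] (hζ : IsPrimitiveRoot ζ 35) :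
    ∃ 𝔣₀ : Ideal (𝓞 (maximalRealSubfield K)),
      𝔣₀.map (algebraMap (𝓞 (maximalRealSubfield K)) (𝓞 K)) = Ideal.span {hζ.toInteger ^ 31 * (1 - hζ.toInteger ^ 7) * (1 - hζ.toInteger ^ 1)} :=
  exists_ideal_map_eq_span_gen (x := ((7, 1, 31) : ℕ × ℕ × ℕ)) hζ adm_thirtyFiveB

omit [NumberField K] in
/-- **`(𝔬𝔣₀)^4 = (5)`** for the type `𝔣₀` with `𝔬𝔣₀ = (π)`, `π = ζ^31(1 − ζ^7)(1 − ζ^1)`: `(π) = (1 − ζ^7)` (the factors `ζ^31`,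
`1 − ζ^1` are units, part 13) and `(1 − ζ^7)^4 = (5)` (part 48c, `ζ^7` a primitive `5`-th root of unity) — so
`N(𝔬𝔣₀) = 5^6`, `N_{K⁺/ℚ}(𝔣₀) = 5^3`: a polarisation of type `𝔣₀` on `ℂ^Φ/Φ(ℤ[ζ_35])` has degree `125`.
research route conditional on HC_CM; not a corollary; Q11.4-sentence-2 already refuted in dim ≥ 3. [cite: Washington1997, Lemma 1.4, Prop. 2.8] -/
theorem map_type_pow_thirtyFiveB (hζ : IsPrimitiveRoot ζ 35) {𝔣₀ : Ideal (𝓞 (maximalRealSubfield K))}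
    (h𝔣₀ : 𝔣₀.map (algebraMap (𝓞 (maximalRealSubfield K)) (𝓞 K)) = Ideal.span {hζ.toInteger ^ 31 * (1 - hζ.toInteger ^ 7) * (1 - hζ.toInteger ^ 1)}) :
    𝔣₀.map (algebraMap (𝓞 (maximalRealSubfield K)) (𝓞 K)) ^ 4 = Ideal.span {(5 : 𝓞 K)} := by
  have hη : IsPrimitiveRoot (ζ ^ 7) 5 := hζ.pow (by norm_num) (by norm_num)
  have hηint : hη.toInteger = hζ.toInteger ^ 7 := RingOfIntegers.ext (by simp [IsPrimitiveRoot.toInteger])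
  have hu1 : IsUnit (hζ.toInteger ^ 31 : 𝓞 K) := (hζ.toInteger_isPrimitiveRoot.isUnit (by norm_num)).pow 31
  have hu2 : IsUnit (1 - hζ.toInteger ^ 1 : 𝓞 K) := isUnit_one_sub_toInteger_pow hζ (by decide) (by decide +kernel)
  rw [h𝔣₀, Ideal.span_singleton_mul_right_unit hu2, Ideal.span_singleton_mul_left_unit hu1, ← hηint]
  exact span_one_sub_pow_eq_five hη

open scoped Classical in
/-- **CENSUS ROW `(ℚ(ζ_35), ℚ(√−7))` (a NO row for principal polarisations) — the RAMIFIED TYPE EXISTS: for every CM type `Φ`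
of `ℚ(ζ_35)` balanced for `N_K = [3, 6, 12, 13, 17, 19, 24, 26, 27, 31, 33, 34]` (the Weil signature `(6,6)` on `K = ℚ(√−7)`) and every type `𝔣₀` with
`𝔬𝔣₀ = (π)`, `π = ζ^31(1 − ζ^7)(1 − ζ^1)`, the principal CM torus `ℂ^Φ/Φ(ℤ[ζ_35])` CARRIES a `Φ`-positive divisor `X_ζ′` of type
`(K; Φ; 𝔣₀)`** — `ζ′^ρ = −ζ′`, `Im φ(ζ′) > 0` on `Φ`, `IsOfType 1 ζ′ 𝔣₀` [Sh98 §14.3 Prop. 4: a polarisation whose `φ_X` is the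
`𝔬𝔣₀`-multiplication, of degree `125`].  Proof: part 48 `exists_type_of_even` + THEOREM L (ii) at `35` + the residue count
`|S_Φ ∩ X_π| ≡ |X_π ∖ N_K| + g/2 = 8 + 6 ≡ 0`.
research route conditional on HC_CM; not a corollary; Q11.4-sentence-2 already refuted in dim ≥ 3. [cite: Shimura1998, §14.3 Prop. 4–5, pp. 103–104] -/
theorem exists_type_thirtyFiveB_sqrt_neg_seven [IsCMField K] [IsCyclotomicExtension {35} ℚ K] (hζ : IsPrimitiveRoot ζ 35)
    (Φ : CMType K) (hbal : 2 * (SΦ[Φ, ζ] ∩ ({3, 6, 12, 13, 17, 19, 24, 26, 27, 31, 33, 34} : Finset (ZMod 35))).card = (SΦ[Φ, ζ]).card)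
    {𝔣₀ : Ideal (𝓞 (maximalRealSubfield K))}
    (h𝔣₀ : 𝔣₀.map (algebraMap (𝓞 (maximalRealSubfield K)) (𝓞 K)) = Ideal.span {hζ.toInteger ^ 31 * (1 - hζ.toInteger ^ 7) * (1 - hζ.toInteger ^ 1)}) :
    ∃ ζ' : K, IsCMField.complexConj K ζ' = -ζ' ∧ (∀ φ : Φ.1, 0 < (φ.1 ζ').im) ∧
        CMTypeLattice.IsOfType (1 : (FractionalIdeal (𝓞 K)⁰ K)ˣ) ζ' 𝔣₀ := by
  have hg : Nat.totient 35 = 2 * (11 + 1) := by decide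
  refine exists_type_of_even hζ hg adm_thirtyFiveB Φ h𝔣₀ (exists_units_sign_eq_thirtyFive hζ Φ) ?_
  rw [twistSet_thirtyFiveB]
  have hS := isCMTypeSet_residueFilter hζ Φ
  have hX : IsCMTypeSet 35 ({2, 4, 6, 9, 11, 13, 16, 18, 23, 27, 32, 34} : Finset (ZMod 35)) := by decide
  have hNK : IsCMTypeSet 35 ({3, 6, 12, 13, 17, 19, 24, 26, 27, 31, 33, 34} : Finset (ZMod 35)) := by decide
  have h1 := card_inter_mod_two_eq hS hX hNK
  have h2 := two_mul_card_eq_card_units hS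
  have hU : (Finset.univ.filter fun t : ZMod 35 => t.val.Coprime 35).card = 24 := by decide
  have h3 : (({2, 4, 6, 9, 11, 13, 16, 18, 23, 27, 32, 34} : Finset (ZMod 35)) \ ({3, 6, 12, 13, 17, 19, 24, 26, 27, 31, 33, 34} : Finset (ZMod 35))).card = 8 := by decide
  rw [Nat.even_iff]
  omega

open scoped Classical in
/-- **CENSUS ROW `(ℚ(ζ_35), ℚ(√−7))`, headline form: there is a type `𝔣₀ ⊆ 𝓞 K⁺` with `(𝔬𝔣₀)^4 = (5)` such that
`ℂ^Φ/Φ(ℤ[ζ_35])` carries a `Φ`-positive divisor of type `(K; Φ; 𝔣₀)`** for every `K`-balanced CM type `Φ`, `K = ℚ(√−7)`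
(polarisation degree `125`; the census's NO row gets an explicit NON-principal polarisation).
research route conditional on HC_CM; not a corollary; Q11.4-sentence-2 already refuted in dim ≥ 3. [cite: Shimura1998, §14.3 Prop. 4–5, pp. 103–104] -/
theorem exists_ramifiedType_thirtyFiveB_sqrt_neg_seven [IsCMField K] [IsCyclotomicExtension {35} ℚ K]
    (hζ : IsPrimitiveRoot ζ 35) (Φ : CMType K) (hbal : 2 * (SΦ[Φ, ζ] ∩ ({3, 6, 12, 13, 17, 19, 24, 26, 27, 31, 33, 34} : Finset (ZMod 35))).card = (SΦ[Φ, ζ]).card) :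
    ∃ 𝔣₀ : Ideal (𝓞 (maximalRealSubfield K)),
      𝔣₀.map (algebraMap (𝓞 (maximalRealSubfield K)) (𝓞 K)) ^ 4 = Ideal.span {(5 : 𝓞 K)} ∧
      ∃ ζ' : K, IsCMField.complexConj K ζ' = -ζ' ∧ (∀ φ : Φ.1, 0 < (φ.1 ζ').im) ∧
        CMTypeLattice.IsOfType (1 : (FractionalIdeal (𝓞 K)⁰ K)ˣ) ζ' 𝔣₀ := by
  obtain ⟨𝔣₀, h𝔣₀⟩ := exists_type_ideal_thirtyFiveB hζ
  exact ⟨𝔣₀, map_type_pow_thirtyFiveB hζ h𝔣₀, exists_type_thirtyFiveB_sqrt_neg_seven hζ Φ hbal h𝔣₀⟩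

open scoped Classical in
/-- **CENSUS ROW `(ℚ(ζ_35), ℚ(√−35))` (a NO row for principal polarisations) — the RAMIFIED TYPE EXISTS: for every CM type `Φ`
of `ℚ(ζ_35)` balanced for `N_K = [2, 6, 8, 18, 19, 22, 23, 24, 26, 31, 32, 34]` (the Weil signature `(6,6)` on `K = ℚ(√−35)`) and every type `𝔣₀` with
`𝔬𝔣₀ = (π)`, `π = ζ^31(1 − ζ^7)(1 − ζ^1)`, the principal CM torus `ℂ^Φ/Φ(ℤ[ζ_35])` CARRIES a `Φ`-positive divisor `X_ζ′` of type
`(K; Φ; 𝔣₀)`** — `ζ′^ρ = −ζ′`, `Im φ(ζ′) > 0` on `Φ`, `IsOfType 1 ζ′ 𝔣₀` [Sh98 §14.3 Prop. 4: a polarisation whose `φ_X` is the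
`𝔬𝔣₀`-multiplication, of degree `125`].  Proof: part 48 `exists_type_of_even` + THEOREM L (ii) at `35` + the residue count
`|S_Φ ∩ X_π| ≡ |X_π ∖ N_K| + g/2 = 6 + 6 ≡ 0`.
research route conditional on HC_CM; not a corollary; Q11.4-sentence-2 already refuted in dim ≥ 3. [cite: Shimura1998, §14.3 Prop. 4–5, pp. 103–104] -/
theorem exists_type_thirtyFiveB_sqrt_neg_thirtyFive [IsCMField K] [IsCyclotomicExtension {35} ℚ K] (hζ : IsPrimitiveRoot ζ 35)
    (Φ : CMType K) (hbal : 2 * (SΦ[Φ, ζ] ∩ ({2, 6, 8, 18, 19, 22, 23, 24, 26, 31, 32, 34} : Finset (ZMod 35))).card = (SΦ[Φ, ζ]).card)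
    {𝔣₀ : Ideal (𝓞 (maximalRealSubfield K))}
    (h𝔣₀ : 𝔣₀.map (algebraMap (𝓞 (maximalRealSubfield K)) (𝓞 K)) = Ideal.span {hζ.toInteger ^ 31 * (1 - hζ.toInteger ^ 7) * (1 - hζ.toInteger ^ 1)}) :
    ∃ ζ' : K, IsCMField.complexConj K ζ' = -ζ' ∧ (∀ φ : Φ.1, 0 < (φ.1 ζ').im) ∧
        CMTypeLattice.IsOfType (1 : (FractionalIdeal (𝓞 K)⁰ K)ˣ) ζ' 𝔣₀ := by
  have hg : Nat.totient 35 = 2 * (11 + 1) := by decide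
  refine exists_type_of_even hζ hg adm_thirtyFiveB Φ h𝔣₀ (exists_units_sign_eq_thirtyFive hζ Φ) ?_
  rw [twistSet_thirtyFiveB]
  have hS := isCMTypeSet_residueFilter hζ Φ
  have hX : IsCMTypeSet 35 ({2, 4, 6, 9, 11, 13, 16, 18, 23, 27, 32, 34} : Finset (ZMod 35)) := by decide
  have hNK : IsCMTypeSet 35 ({2, 6, 8, 18, 19, 22, 23, 24, 26, 31, 32, 34} : Finset (ZMod 35)) := by decide
  have h1 := card_inter_mod_two_eq hS hX hNK
  have h2 := two_mul_card_eq_card_units hS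
  have hU : (Finset.univ.filter fun t : ZMod 35 => t.val.Coprime 35).card = 24 := by decide
  have h3 : (({2, 4, 6, 9, 11, 13, 16, 18, 23, 27, 32, 34} : Finset (ZMod 35)) \ ({2, 6, 8, 18, 19, 22, 23, 24, 26, 31, 32, 34} : Finset (ZMod 35))).card = 6 := by decide
  rw [Nat.even_iff]
  omega

open scoped Classical in
/-- **CENSUS ROW `(ℚ(ζ_35), ℚ(√−35))`, headline form: there is a type `𝔣₀ ⊆ 𝓞 K⁺` with `(𝔬𝔣₀)^4 = (5)` such that
`ℂ^Φ/Φ(ℤ[ζ_35])` carries a `Φ`-positive divisor of type `(K; Φ; 𝔣₀)`** for every `K`-balanced CM type `Φ`, `K = ℚ(√−35)`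
(polarisation degree `125`; the census's NO row gets an explicit NON-principal polarisation).
research route conditional on HC_CM; not a corollary; Q11.4-sentence-2 already refuted in dim ≥ 3. [cite: Shimura1998, §14.3 Prop. 4–5, pp. 103–104] -/
theorem exists_ramifiedType_thirtyFiveB_sqrt_neg_thirtyFive [IsCMField K] [IsCyclotomicExtension {35} ℚ K]
    (hζ : IsPrimitiveRoot ζ 35) (Φ : CMType K) (hbal : 2 * (SΦ[Φ, ζ] ∩ ({2, 6, 8, 18, 19, 22, 23, 24, 26, 31, 32, 34} : Finset (ZMod 35))).card = (SΦ[Φ, ζ]).card) :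
    ∃ 𝔣₀ : Ideal (𝓞 (maximalRealSubfield K)),
      𝔣₀.map (algebraMap (𝓞 (maximalRealSubfield K)) (𝓞 K)) ^ 4 = Ideal.span {(5 : 𝓞 K)} ∧
      ∃ ζ' : K, IsCMField.complexConj K ζ' = -ζ' ∧ (∀ φ : Φ.1, 0 < (φ.1 ζ').im) ∧
        CMTypeLattice.IsOfType (1 : (FractionalIdeal (𝓞 K)⁰ K)ˣ) ζ' 𝔣₀ := by
  obtain ⟨𝔣₀, h𝔣₀⟩ := exists_type_ideal_thirtyFiveB hζ
  exact ⟨𝔣₀, map_type_pow_thirtyFiveB hζ h𝔣₀, exists_type_thirtyFiveB_sqrt_neg_thirtyFive hζ Φ hbal h𝔣₀⟩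

end Level35

section Level45

/-- the residue set `S_Φ` read at level `45`. -/
local notation3 (prettyPrint := false) "SΦ[" Φ "," z "]" =>
  (Finset.univ.filter fun t : ZMod 45 => ∃ σ ∈ (Φ : CMType K).1, σ (z : K) = 𝐞 t)

/-- part 48's twisted sign set `X_π` at level `45` (`n := 45`). -/
local notation3 (prettyPrint := false) "Xtw45 " x:max =>
  (Finset.univ.filter fun t : ZMod 45 => t.val.Coprime 45 ∧
    ¬ ((45 < (x : ℕ × ℕ × ℕ).1 * ZMod.val t % (2 * 45) ↔ 45 < (x : ℕ × ℕ × ℕ).2.1 * ZMod.val t % (2 * 45)) ↔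
      Even (Finset.card (Finset.filter (fun s : ZMod 45 => s.val.Coprime 45 ∧ s.val < t.val) Finset.univ))))

/-- the census's `N_odd` at level `45` (part 5). -/
local notation3 (prettyPrint := false) "Nodd45" =>
  (Finset.univ.filter fun t : ZMod 45 => t.val.Coprime 45 ∧
    Even (Finset.card (Finset.filter (fun s : ZMod 45 => s.val.Coprime 45 ∧ s.val < t.val) Finset.univ)))

/-! #### Level `45`, the type `𝔣₀` with `𝔬𝔣₀ = (π)`, `π = ζ^40(1 − ζ^9)(1 − ζ^1)` (`ζ^9` a primitive `5`-th root of unity: `(π) = (1 − ζ^9)`, `(π)^4 = (5)`) -/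

/-- the semi-admissibility of `x = (9, 1, 40)` at level `45` (`45 ∤ 9, 1`; `2·40 + 9 + 1 ≡ 0 (mod 90)`). [folklore] -/
theorem adm_fortyFiveB : ¬ 45 ∣ ((9, 1, 40) : ℕ × ℕ × ℕ).1 ∧ ¬ 45 ∣ ((9, 1, 40) : ℕ × ℕ × ℕ).2.1 ∧
    (2 * ((9, 1, 40) : ℕ × ℕ × ℕ).2.2 + ((9, 1, 40) : ℕ × ℕ × ℕ).1 + ((9, 1, 40) : ℕ × ℕ × ℕ).2.1) % (2 * 45) = 0 := by
  decide

/-- **The twisted sign set at level `45` for `π = ζ^40(1 − ζ^9)(1 − ζ^1)`: `X_π = N_odd ∆ A_π = [2, 8, 11, 14, 16, 19, 22, 28, 32, 38, 41, 44]`** (`A_π = [1, 2, 4, 11, 13, 14, 22, 23, 31, 32, 34, 41, 43, 44]`, `|A_π|/2 = 7`;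
`decide`).
research route conditional on HC_CM; not a corollary; Q11.4-sentence-2 already refuted in dim ≥ 3. [folklore] -/
theorem twistSet_fortyFiveB : Xtw45 ((9, 1, 40) : ℕ × ℕ × ℕ) = ({2, 8, 11, 14, 16, 19, 22, 28, 32, 38, 41, 44} : Finset (ZMod 45)) := by
  decide

/-- **A type `𝔣₀ ⊆ 𝓞 K⁺` with `𝔬𝔣₀ = (π)`, `π = ζ^40(1 − ζ^9)(1 − ζ^1)`, EXISTS** (part 48 `exists_ideal_map_eq_span_gen`).
research route conditional on HC_CM; not a corollary; Q11.4-sentence-2 already refuted in dim ≥ 3. [cite: Shimura1998, §14.3, p. 103] -/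
theorem exists_type_ideal_fortyFiveB [IsCMField K] (hζ : IsPrimitiveRoot ζ 45) :
    ∃ 𝔣₀ : Ideal (𝓞 (maximalRealSubfield K)),
      𝔣₀.map (algebraMap (𝓞 (maximalRealSubfield K)) (𝓞 K)) = Ideal.span {hζ.toInteger ^ 40 * (1 - hζ.toInteger ^ 9) * (1 - hζ.toInteger ^ 1)} :=
  exists_ideal_map_eq_span_gen (x := ((9, 1, 40) : ℕ × ℕ × ℕ)) hζ adm_fortyFiveB

omit [NumberField K] in
/-- **`(𝔬𝔣₀)^4 = (5)`** for the type `𝔣₀` with `𝔬𝔣₀ = (π)`, `π = ζ^40(1 − ζ^9)(1 − ζ^1)`: `(π) = (1 − ζ^9)` (the factors `ζ^40`,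
`1 − ζ^1` are units, part 13) and `(1 − ζ^9)^4 = (5)` (part 48c, `ζ^9` a primitive `5`-th root of unity) — so
`N(𝔬𝔣₀) = 5^6`, `N_{K⁺/ℚ}(𝔣₀) = 5^3`: a polarisation of type `𝔣₀` on `ℂ^Φ/Φ(ℤ[ζ_45])` has degree `125`.
research route conditional on HC_CM; not a corollary; Q11.4-sentence-2 already refuted in dim ≥ 3. [cite: Washington1997, Lemma 1.4, Prop. 2.8] -/
theorem map_type_pow_fortyFiveB (hζ : IsPrimitiveRoot ζ 45) {𝔣₀ : Ideal (𝓞 (maximalRealSubfield K))}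
    (h𝔣₀ : 𝔣₀.map (algebraMap (𝓞 (maximalRealSubfield K)) (𝓞 K)) = Ideal.span {hζ.toInteger ^ 40 * (1 - hζ.toInteger ^ 9) * (1 - hζ.toInteger ^ 1)}) :
    𝔣₀.map (algebraMap (𝓞 (maximalRealSubfield K)) (𝓞 K)) ^ 4 = Ideal.span {(5 : 𝓞 K)} := by
  have hη : IsPrimitiveRoot (ζ ^ 9) 5 := hζ.pow (by norm_num) (by norm_num)
  have hηint : hη.toInteger = hζ.toInteger ^ 9 := RingOfIntegers.ext (by simp [IsPrimitiveRoot.toInteger])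
  have hu1 : IsUnit (hζ.toInteger ^ 40 : 𝓞 K) := (hζ.toInteger_isPrimitiveRoot.isUnit (by norm_num)).pow 40
  have hu2 : IsUnit (1 - hζ.toInteger ^ 1 : 𝓞 K) := isUnit_one_sub_toInteger_pow hζ (by decide) (by decide +kernel)
  rw [h𝔣₀, Ideal.span_singleton_mul_right_unit hu2, Ideal.span_singleton_mul_left_unit hu1, ← hηint]
  exact span_one_sub_pow_eq_five hη

open scoped Classical in
/-- **CENSUS ROW `(ℚ(ζ_45), ℚ(√−3))` (a NO row for principal polarisations) — the RAMIFIED TYPE EXISTS: for every CM type `Φ`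
of `ℚ(ζ_45)` balanced for `N_K = [2, 8, 11, 14, 17, 23, 26, 29, 32, 38, 41, 44]` (the Weil signature `(6,6)` on `K = ℚ(√−3)`) and every type `𝔣₀` with
`𝔬𝔣₀ = (π)`, `π = ζ^40(1 − ζ^9)(1 − ζ^1)`, the principal CM torus `ℂ^Φ/Φ(ℤ[ζ_45])` CARRIES a `Φ`-positive divisor `X_ζ′` of type
`(K; Φ; 𝔣₀)`** — `ζ′^ρ = −ζ′`, `Im φ(ζ′) > 0` on `Φ`, `IsOfType 1 ζ′ 𝔣₀` [Sh98 §14.3 Prop. 4: a polarisation whose `φ_X` is the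
`𝔬𝔣₀`-multiplication, of degree `125`].  Proof: part 48 `exists_type_of_even` + THEOREM L (ii) at `45` + the residue count
`|S_Φ ∩ X_π| ≡ |X_π ∖ N_K| + g/2 = 4 + 6 ≡ 0`.
research route conditional on HC_CM; not a corollary; Q11.4-sentence-2 already refuted in dim ≥ 3. [cite: Shimura1998, §14.3 Prop. 4–5, pp. 103–104] -/
theorem exists_type_fortyFiveB_sqrt_neg_three [IsCMField K] [IsCyclotomicExtension {45} ℚ K] (hζ : IsPrimitiveRoot ζ 45)
    (Φ : CMType K) (hbal : 2 * (SΦ[Φ, ζ] ∩ ({2, 8, 11, 14, 17, 23, 26, 29, 32, 38, 41, 44} : Finset (ZMod 45))).card = (SΦ[Φ, ζ]).card)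
    {𝔣₀ : Ideal (𝓞 (maximalRealSubfield K))}
    (h𝔣₀ : 𝔣₀.map (algebraMap (𝓞 (maximalRealSubfield K)) (𝓞 K)) = Ideal.span {hζ.toInteger ^ 40 * (1 - hζ.toInteger ^ 9) * (1 - hζ.toInteger ^ 1)}) :
    ∃ ζ' : K, IsCMField.complexConj K ζ' = -ζ' ∧ (∀ φ : Φ.1, 0 < (φ.1 ζ').im) ∧
        CMTypeLattice.IsOfType (1 : (FractionalIdeal (𝓞 K)⁰ K)ˣ) ζ' 𝔣₀ := by
  have hg : Nat.totient 45 = 2 * (11 + 1) := by decide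
  refine exists_type_of_even hζ hg adm_fortyFiveB Φ h𝔣₀ (exists_units_sign_eq_fortyFive hζ Φ) ?_
  rw [twistSet_fortyFiveB]
  have hS := isCMTypeSet_residueFilter hζ Φ
  have hX : IsCMTypeSet 45 ({2, 8, 11, 14, 16, 19, 22, 28, 32, 38, 41, 44} : Finset (ZMod 45)) := by decide
  have hNK : IsCMTypeSet 45 ({2, 8, 11, 14, 17, 23, 26, 29, 32, 38, 41, 44} : Finset (ZMod 45)) := by decide
  have h1 := card_inter_mod_two_eq hS hX hNK
  have h2 := two_mul_card_eq_card_units hS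
  have hU : (Finset.univ.filter fun t : ZMod 45 => t.val.Coprime 45).card = 24 := by decide
  have h3 : (({2, 8, 11, 14, 16, 19, 22, 28, 32, 38, 41, 44} : Finset (ZMod 45)) \ ({2, 8, 11, 14, 17, 23, 26, 29, 32, 38, 41, 44} : Finset (ZMod 45))).card = 4 := by decide
  rw [Nat.even_iff]
  omega

open scoped Classical in
/-- **CENSUS ROW `(ℚ(ζ_45), ℚ(√−3))`, headline form: there is a type `𝔣₀ ⊆ 𝓞 K⁺` with `(𝔬𝔣₀)^4 = (5)` such that
`ℂ^Φ/Φ(ℤ[ζ_45])` carries a `Φ`-positive divisor of type `(K; Φ; 𝔣₀)`** for every `K`-balanced CM type `Φ`, `K = ℚ(√−3)`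
(polarisation degree `125`; the census's NO row gets an explicit NON-principal polarisation).
research route conditional on HC_CM; not a corollary; Q11.4-sentence-2 already refuted in dim ≥ 3. [cite: Shimura1998, §14.3 Prop. 4–5, pp. 103–104] -/
theorem exists_ramifiedType_fortyFiveB_sqrt_neg_three [IsCMField K] [IsCyclotomicExtension {45} ℚ K]
    (hζ : IsPrimitiveRoot ζ 45) (Φ : CMType K) (hbal : 2 * (SΦ[Φ, ζ] ∩ ({2, 8, 11, 14, 17, 23, 26, 29, 32, 38, 41, 44} : Finset (ZMod 45))).card = (SΦ[Φ, ζ]).card) :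
    ∃ 𝔣₀ : Ideal (𝓞 (maximalRealSubfield K)),
      𝔣₀.map (algebraMap (𝓞 (maximalRealSubfield K)) (𝓞 K)) ^ 4 = Ideal.span {(5 : 𝓞 K)} ∧
      ∃ ζ' : K, IsCMField.complexConj K ζ' = -ζ' ∧ (∀ φ : Φ.1, 0 < (φ.1 ζ').im) ∧
        CMTypeLattice.IsOfType (1 : (FractionalIdeal (𝓞 K)⁰ K)ˣ) ζ' 𝔣₀ := by
  obtain ⟨𝔣₀, h𝔣₀⟩ := exists_type_ideal_fortyFiveB hζ
  exact ⟨𝔣₀, map_type_pow_fortyFiveB hζ h𝔣₀, exists_type_fortyFiveB_sqrt_neg_three hζ Φ hbal h𝔣₀⟩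

open scoped Classical in
/-- **CENSUS ROW `(ℚ(ζ_45), ℚ(√−15))` (a NO row for principal polarisations) — the RAMIFIED TYPE EXISTS: for every CM type `Φ`
of `ℚ(ζ_45)` balanced for `N_K = [7, 11, 13, 14, 22, 26, 28, 29, 37, 41, 43, 44]` (the Weil signature `(6,6)` on `K = ℚ(√−15)`) and every type `𝔣₀` with
`𝔬𝔣₀ = (π)`, `π = ζ^40(1 − ζ^9)(1 − ζ^1)`, the principal CM torus `ℂ^Φ/Φ(ℤ[ζ_45])` CARRIES a `Φ`-positive divisor `X_ζ′` of type
`(K; Φ; 𝔣₀)`** — `ζ′^ρ = −ζ′`, `Im φ(ζ′) > 0` on `Φ`, `IsOfType 1 ζ′ 𝔣₀` [Sh98 §14.3 Prop. 4: a polarisation whose `φ_X` is the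
`𝔬𝔣₀`-multiplication, of degree `125`].  Proof: part 48 `exists_type_of_even` + THEOREM L (ii) at `45` + the residue count
`|S_Φ ∩ X_π| ≡ |X_π ∖ N_K| + g/2 = 6 + 6 ≡ 0`.
research route conditional on HC_CM; not a corollary; Q11.4-sentence-2 already refuted in dim ≥ 3. [cite: Shimura1998, §14.3 Prop. 4–5, pp. 103–104] -/
theorem exists_type_fortyFiveB_sqrt_neg_fifteen [IsCMField K] [IsCyclotomicExtension {45} ℚ K] (hζ : IsPrimitiveRoot ζ 45)
    (Φ : CMType K) (hbal : 2 * (SΦ[Φ, ζ] ∩ ({7, 11, 13, 14, 22, 26, 28, 29, 37, 41, 43, 44} : Finset (ZMod 45))).card = (SΦ[Φ, ζ]).card)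
    {𝔣₀ : Ideal (𝓞 (maximalRealSubfield K))}
    (h𝔣₀ : 𝔣₀.map (algebraMap (𝓞 (maximalRealSubfield K)) (𝓞 K)) = Ideal.span {hζ.toInteger ^ 40 * (1 - hζ.toInteger ^ 9) * (1 - hζ.toInteger ^ 1)}) :
    ∃ ζ' : K, IsCMField.complexConj K ζ' = -ζ' ∧ (∀ φ : Φ.1, 0 < (φ.1 ζ').im) ∧
        CMTypeLattice.IsOfType (1 : (FractionalIdeal (𝓞 K)⁰ K)ˣ) ζ' 𝔣₀ := by
  have hg : Nat.totient 45 = 2 * (11 + 1) := by decide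
  refine exists_type_of_even hζ hg adm_fortyFiveB Φ h𝔣₀ (exists_units_sign_eq_fortyFive hζ Φ) ?_
  rw [twistSet_fortyFiveB]
  have hS := isCMTypeSet_residueFilter hζ Φ
  have hX : IsCMTypeSet 45 ({2, 8, 11, 14, 16, 19, 22, 28, 32, 38, 41, 44} : Finset (ZMod 45)) := by decide
  have hNK : IsCMTypeSet 45 ({7, 11, 13, 14, 22, 26, 28, 29, 37, 41, 43, 44} : Finset (ZMod 45)) := by decide
  have h1 := card_inter_mod_two_eq hS hX hNK
  have h2 := two_mul_card_eq_card_units hS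
  have hU : (Finset.univ.filter fun t : ZMod 45 => t.val.Coprime 45).card = 24 := by decide
  have h3 : (({2, 8, 11, 14, 16, 19, 22, 28, 32, 38, 41, 44} : Finset (ZMod 45)) \ ({7, 11, 13, 14, 22, 26, 28, 29, 37, 41, 43, 44} : Finset (ZMod 45))).card = 6 := by decide
  rw [Nat.even_iff]
  omega

open scoped Classical in
/-- **CENSUS ROW `(ℚ(ζ_45), ℚ(√−15))`, headline form: there is a type `𝔣₀ ⊆ 𝓞 K⁺` with `(𝔬𝔣₀)^4 = (5)` such that
`ℂ^Φ/Φ(ℤ[ζ_45])` carries a `Φ`-positive divisor of type `(K; Φ; 𝔣₀)`** for every `K`-balanced CM type `Φ`, `K = ℚ(√−15)`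
(polarisation degree `125`; the census's NO row gets an explicit NON-principal polarisation).
research route conditional on HC_CM; not a corollary; Q11.4-sentence-2 already refuted in dim ≥ 3. [cite: Shimura1998, §14.3 Prop. 4–5, pp. 103–104] -/
theorem exists_ramifiedType_fortyFiveB_sqrt_neg_fifteen [IsCMField K] [IsCyclotomicExtension {45} ℚ K]
    (hζ : IsPrimitiveRoot ζ 45) (Φ : CMType K) (hbal : 2 * (SΦ[Φ, ζ] ∩ ({7, 11, 13, 14, 22, 26, 28, 29, 37, 41, 43, 44} : Finset (ZMod 45))).card = (SΦ[Φ, ζ]).card) :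
    ∃ 𝔣₀ : Ideal (𝓞 (maximalRealSubfield K)),
      𝔣₀.map (algebraMap (𝓞 (maximalRealSubfield K)) (𝓞 K)) ^ 4 = Ideal.span {(5 : 𝓞 K)} ∧
      ∃ ζ' : K, IsCMField.complexConj K ζ' = -ζ' ∧ (∀ φ : Φ.1, 0 < (φ.1 ζ').im) ∧
        CMTypeLattice.IsOfType (1 : (FractionalIdeal (𝓞 K)⁰ K)ˣ) ζ' 𝔣₀ := by
  obtain ⟨𝔣₀, h𝔣₀⟩ := exists_type_ideal_fortyFiveB hζ
  exact ⟨𝔣₀, map_type_pow_fortyFiveB hζ h𝔣₀, exists_type_fortyFiveB_sqrt_neg_fifteen hζ Φ hbal h𝔣₀⟩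

end Level45

end Summit.HodgeConjecture.Ring2WeilCoverage.RamifiedTypesLevels35and45PrimeFive

end
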